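import Literature.MathematicalPhysics.QuantumFieldTheory.BalabanImbrieJaffe1984to88.BIJ88TruncatedExpectation5142
import Literature.MathematicalPhysics.QuantumFieldTheory.Balaban1983to89.B10Eq24Cumulant
import Literature.Probability.LatticeModels.UrsellExplicitFormula

/-!
# `Balaban1983to89.B1Eq323SetPartitions` — T. Bałaban, *(Higgs)₂,₃ quantum fields in a finite volume. I. A lower bound*, Commun. Math.
Phys. **85** (1982) 603–636 [Balaban1982Higgs1], (3.23) p. 616: **the truncated expectations «and so on» — the moment–cumulant relation AT
ALL ORDERS in closed (set-partition) form**, for the row-of-record objects `nmoment` / `truncExp` of `Balaban1983to89.B10Eq24Cumulant`.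

statement-level skeleton of published theorems with citation tags; proofs where landed; nothing here is a claim about the Yang–Mills mass gap

THE PRINT (verbatim, p. 616 [PDF 14]; quoted from the header of `B1Eq324CumulantTaylor`, whose author read the x2 render
`pub-balaban/b2b-balaban-ref1/pages/1982-cmp85-higgs23-I/…p014`): *"we use the cumulant expansion formula of the form
⟨exp(V)⟩ = exp[⟨V⟩ + (1/2!)⟨V²⟩^T + (1/3!)⟨V³⟩^T + …], (3.23) where ⟨·⟩ denotes the expectation value with respect to the measure
dμ_{C⁽⁰⁾}(A′)dμ_{C⁽⁰⁾(B⁽¹⁾)}(φ′), V = V⁽⁰⁾ and ⟨Vⁿ⟩^T denotes the truncated expectation of a product of n polynomials V, thus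
⟨V²⟩^T = ⟨V²⟩ − ⟨V⟩², ⟨V³⟩^T = ⟨V³⟩ − 3⟨V²⟩⟨V⟩ + ⟨V⟩³* [sic] *, and so on."*

WHAT IS PROVED (theorems only; unit `lit-balaban-p36` gen 9; row **B1.Eq3.23** of SKELETON.md, owner r12; the tree already holds the
RECURSION `B10Eq24Cumulant.nmoment_succ` and the orders 1–4 `truncExp_one…four`; NEW here is the closed form of all orders and uniqueness):
* **`nmoment_card_eq_sum_setPartitions`** / `nmoment_eq_sum_setPartitions_fin` — for a bounded `V` under a finite non-zero measure and
  every finite label set `K` (resp. every `n`): `⟨V^{|K|}⟩ = Σ_{π ∈ 𝒫(K)} Π_{P∈π} ⟨V^{|P|}⟩ᵀ`, i.e. the «and so on» of (3.23) at all orders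
  (`|K| = 2, 3`: the two printed instances, the second in its corrected form `+2⟨V⟩³`, cf. `B10Eq24Cumulant.truncExp_three` /
  `B1Sect3Statements.trunc3_printed`).  Proof: the set-partition exponential formula
  `BIJ88TruncatedExpectation5142.iteratedDerivWithin_eq_mul_sum_setPartitions` (any positive smooth `z`) applied to `z = mgf V ν` on
  `s = ℝ` (`⟨Vⁿ⟩ = Z⁽ⁿ⁾(0)/Z(0)`, `⟨Vⁿ⟩ᵀ = (log Z)⁽ⁿ⁾(0)`).
* **`trunc_eq_truncExp`** — (3.23) DEFINES `⟨Vⁿ⟩ᵀ`: any cardinality-indexed family solving these relations up to order `|V₀|` equals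
  `truncExp` there (`BIJ88TruncatedExpectation5142.trunc_unique`).
* §2 (v1.1) **bridge to `Literature.Probability.LatticeModels`** (Ruelle's Möbius inversion `ursellOf`, the cumulants `cumulantOf` of a
  moment sequence): `ursellOf_nmoment_eq_truncExp` (`⟨V^{|K|}⟩ᵀ` is the Ursell function of `P ↦ ⟨V^{|P|}⟩`),
  `truncExp_eq_cumulantOf_nmoment` (`⟨Vⁿ⟩ᵀ = κₙ(⟨V^·⟩)`, `n ≥ 1`), and **the EXPLICIT formula at all orders**
  `truncExp_eq_sum_setPartitions_moebius` / `truncExp_card_eq_sum_setPartitions_moebius`: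
  `⟨Vⁿ⟩ᵀ = Σ_{π ∈ 𝒫({1,…,n})} (−1)^{|π|−1}(|π|−1)! Π_{P∈π} ⟨V^{|P|}⟩` — the two printed instances continued to every order
  (`LatticeModels.cumulantOf_eq_sum_setPartitions`, the Möbius function of the partition lattice).

HONEST SCOPE.  `⟨·⟩` = normalised expectation of a finite non-zero measure `ν` (for B1: the Gaussian measure, or `χ·μ` as in
`B10Eq24Cumulant` §4), `V` bounded `ν`-a.e. and a.e.-measurable (the standing hypotheses of `B10Eq24Cumulant`); (3.24) and the lemma of
Benfatto et al. are not touched.  0 `sorry`; axioms standard.  NOT summit progress.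

CITATION HEADER (lean-in-tree rule).  lit-balaban TYPED SKELETON (HOME `run/shared/lean/pub/lit-balaban/`), Phase 2, seat p36 gen 9
(cross-block by-name addition, free-target protocol G.5-34(d); TAKING HOME/STATUS 2026-08-22T00:57Z).  PDF held:
`paper:balaban1982-cmp85-higgs23-i` (journal page = PDF page + 602).
-/

open Finset MeasureTheory ProbabilityTheory
open Literature.Probability.LatticeModels (setPartitions ursellOf cumulantOf eq_ursellOf_of_forall cumulantOf_eq_sum_setPartitions
  ursellOf_eq_sum_setPartitions)
open Literature.MathematicalPhysics.QuantumFieldTheory.Balaban1983to89.B10Eq24Cumulant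
open Literature.MathematicalPhysics.QuantumFieldTheory.BalabanImbrieJaffe1984to88.BIJ88TruncatedExpectation5142
  (trunc_unique iteratedDerivWithin_eq_mul_sum_setPartitions)

namespace Literature.MathematicalPhysics.QuantumFieldTheory.Balaban1983to89.B1Eq323SetPartitions

variable {Ω : Type*} {mΩ : MeasurableSpace Ω} {V : Ω → ℝ} {ν : Measure Ω} {B : ℝ} [IsFiniteMeasure ν]
variable {α : Type*} [DecidableEq α]

/-- `Z = mgf V ν` is `Cⁿ` on all of ℝ for bounded `V` (analytic at every point). [cite: Balaban1982Higgs1, (3.23) p.616] -/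
theorem contDiffOn_mgf_of_abs_le (hV : AEMeasurable V ν) (hB : ∀ᵐ ω ∂ν, |V ω| ≤ B) (n : ℕ) :
    ContDiffOn ℝ n (mgf V ν) Set.univ :=
  (contDiff_iff_contDiffAt.2 fun t => (analyticAt_mgf_of_abs_le hV hB t).contDiffAt).contDiffOn

/-- `⟨Vⁿ⟩ = Z⁽ⁿ⁾(0)/Z(0)`: the normalised moments are the derivative moments of `Z = mgf V ν` at `t = 0`.
[cite: Balaban1982Higgs1, (3.23) p.616] -/
theorem nmoment_eq_iteratedDeriv_div (hV : AEMeasurable V ν) (hB : ∀ᵐ ω ∂ν, |V ω| ≤ B) (n : ℕ) :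
    nmoment V ν n = iteratedDeriv n (mgf V ν) 0 / mgf V ν 0 := by
  rw [nmoment, iteratedDeriv_mgf_zero_of_abs_le hV hB, mgf_zero']

/-- **(3.23) «and so on», ALL ORDERS, CLOSED FORM — the moment–cumulant relation over set partitions.** For a bounded `V` under a
finite non-zero measure and every finite label set `K`:
`⟨V^{|K|}⟩ = Σ_{π ∈ 𝒫(K)} Π_{P ∈ π} ⟨V^{|P|}⟩ᵀ`
(`nmoment`, `truncExp` of `B10Eq24Cumulant`; `|K| = 2, 3` give the printed `⟨V²⟩ᵀ = ⟨V²⟩ − ⟨V⟩²`, `⟨V³⟩ᵀ = ⟨V³⟩ − 3⟨V²⟩⟨V⟩ + 2⟨V⟩³`).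
The exponential formula `BIJ88TruncatedExpectation5142.iteratedDerivWithin_eq_mul_sum_setPartitions` for `z = mgf V ν` on `s = ℝ`.
[cite: Balaban1982Higgs1, (3.23) p.616] -/
theorem nmoment_card_eq_sum_setPartitions [NeZero ν] (hV : AEMeasurable V ν) (hB : ∀ᵐ ω ∂ν, |V ω| ≤ B) (K : Finset α) :
    nmoment V ν K.card = ∑ π ∈ setPartitions K, ∏ P ∈ π, truncExp V ν P.card := by
  have hpos : ∀ x ∈ (Set.univ : Set ℝ), 0 < mgf V ν x := fun x _ => mgf_pos_of_abs_le hV hB x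
  have h := iteratedDerivWithin_eq_mul_sum_setPartitions uniqueDiffOn_univ (Set.mem_univ (0 : ℝ))
    (contDiffOn_mgf_of_abs_le hV hB K.card) hpos K le_rfl
  simp only [iteratedDerivWithin_univ] at h
  rw [nmoment_eq_iteratedDeriv_div hV hB, h, mul_div_cancel_left₀ _ (mgf_pos_of_abs_le hV hB 0).ne']
  rfl

/-- The same indexed by `n` (labels `Fin n`): `⟨Vⁿ⟩ = Σ_{π ∈ 𝒫({1,…,n})} Π_{P∈π} ⟨V^{|P|}⟩ᵀ`. [cite: Balaban1982Higgs1, (3.23) p.616] -/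
theorem nmoment_eq_sum_setPartitions_fin [NeZero ν] (hV : AEMeasurable V ν) (hB : ∀ᵐ ω ∂ν, |V ω| ≤ B) (n : ℕ) :
    nmoment V ν n = ∑ π ∈ setPartitions (univ : Finset (Fin n)), ∏ P ∈ π, truncExp V ν P.card := by
  have h := nmoment_card_eq_sum_setPartitions hV hB (univ : Finset (Fin n))
  rwa [card_univ, Fintype.card_fin] at h

/-- **The truncated expectations are DETERMINED by (3.23)**: any cardinality-indexed family `κ` solving the moment–truncation relations
of all orders `≤ |V₀|` against the normalised moments coincides with `⟨V^{·}⟩ᵀ = truncExp` there (uniqueness,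
`BIJ88TruncatedExpectation5142.trunc_unique`) — (3.23) DEFINES `⟨Vⁿ⟩ᵀ`, as `B10Eq24Cumulant.truncExp` records.
[cite: Balaban1982Higgs1, (3.23) p.616] -/
theorem trunc_eq_truncExp [NeZero ν] (hV : AEMeasurable V ν) (hB : ∀ᵐ ω ∂ν, |V ω| ≤ B) {V₀ : Finset α} {κ : ℕ → ℝ}
    (hκ : ∀ K ⊆ V₀, K.Nonempty → nmoment V ν K.card = ∑ π ∈ setPartitions K, ∏ P ∈ π, κ P.card) :
    ∀ K ⊆ V₀, K.Nonempty → κ K.card = truncExp V ν K.card :=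
  trunc_unique (m := fun K => nmoment V ν K.card) (κ₁ := fun K => κ K.card) (κ₂ := fun K => truncExp V ν K.card) hκ
    fun K _ _ => nmoment_card_eq_sum_setPartitions hV hB K

/-! ## §2  Bridge to the Möbius-inversion vocabulary of `Literature.Probability.LatticeModels` and the EXPLICIT formula at all orders -/

/-- **`⟨V^{|K|}⟩ᵀ` is the Ursell function of the moments**: for every nonempty finite `K`, the Möbius inverse
`LatticeModels.ursellOf` of the cardinality-indexed moment function `P ↦ ⟨V^{|P|}⟩` at `K` is `truncExp V ν |K|`
(uniqueness of Möbius inversion, `LatticeModels.eq_ursellOf_of_forall`). [cite: Balaban1982Higgs1, (3.23) p.616] -/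
theorem ursellOf_nmoment_eq_truncExp [NeZero ν] (hV : AEMeasurable V ν) (hB : ∀ᵐ ω ∂ν, |V ω| ≤ B) {K : Finset α}
    (hK : K.Nonempty) : ursellOf (fun P : Finset α => nmoment V ν P.card) K = truncExp V ν K.card :=
  (eq_ursellOf_of_forall (fun P : Finset α => nmoment V ν P.card) (fun P => truncExp V ν P.card)
    (fun W _ => (nmoment_card_eq_sum_setPartitions hV hB W).symm) hK).symm

/-- **`⟨Vⁿ⟩ᵀ = κₙ(⟨V^·⟩)`**: B1's truncated expectations are the cumulants `LatticeModels.cumulantOf` of the normalised moment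
sequence (`n ≥ 1`; at `n = 0`, `truncExp V ν 0 = log ν(univ)` while `cumulantOf _ 0` is a junk value).
[cite: Balaban1982Higgs1, (3.23) p.616] -/
theorem truncExp_eq_cumulantOf_nmoment [NeZero ν] (hV : AEMeasurable V ν) (hB : ∀ᵐ ω ∂ν, |V ω| ≤ B) {n : ℕ} (hn : 0 < n) :
    truncExp V ν n = cumulantOf (nmoment V ν) n := by
  haveI : Nonempty (Fin n) := ⟨⟨0, hn⟩⟩
  have h := ursellOf_nmoment_eq_truncExp hV hB (univ_nonempty (α := Fin n))
  rw [card_univ, Fintype.card_fin] at h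
  rw [← h, cumulantOf]

/-- **(3.23) EXPLICITLY, ALL ORDERS: `⟨Vⁿ⟩ᵀ = Σ_{π ∈ 𝒫({1,…,n})} (−1)^{|π|−1} (|π|−1)! Π_{P∈π} ⟨V^{|P|}⟩`** (`n ≥ 1`) — the
pattern of the two printed instances `⟨V²⟩ᵀ = ⟨V²⟩ − ⟨V⟩²`, `⟨V³⟩ᵀ = ⟨V³⟩ − 3⟨V²⟩⟨V⟩ + 2⟨V⟩³` (corrected sign/coefficient of the
print's `+⟨V⟩³`, cf. `B1Sect3Statements.trunc3_printed`) continued to every order: the Möbius function of the partition lattice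
(`LatticeModels.cumulantOf_eq_sum_setPartitions`). [cite: Balaban1982Higgs1, (3.23) p.616] -/
theorem truncExp_eq_sum_setPartitions_moebius [NeZero ν] (hV : AEMeasurable V ν) (hB : ∀ᵐ ω ∂ν, |V ω| ≤ B) {n : ℕ}
    (hn : 0 < n) : truncExp V ν n = ∑ π ∈ setPartitions (univ : Finset (Fin n)),
      (-1 : ℝ) ^ (π.card - 1) * ((π.card - 1).factorial : ℝ) * ∏ P ∈ π, nmoment V ν P.card := by
  rw [truncExp_eq_cumulantOf_nmoment hV hB hn]
  exact cumulantOf_eq_sum_setPartitions _ (nmoment_zero V) hn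

/-- The same over an arbitrary nonempty finite label set `K`:
`⟨V^{|K|}⟩ᵀ = Σ_{π ∈ 𝒫(K)} (−1)^{|π|−1} (|π|−1)! Π_{P∈π} ⟨V^{|P|}⟩`. [cite: Balaban1982Higgs1, (3.23) p.616] -/
theorem truncExp_card_eq_sum_setPartitions_moebius [NeZero ν] (hV : AEMeasurable V ν) (hB : ∀ᵐ ω ∂ν, |V ω| ≤ B)
    {K : Finset α} (hK : K.Nonempty) : truncExp V ν K.card = ∑ π ∈ setPartitions K,
      (-1 : ℝ) ^ (π.card - 1) * ((π.card - 1).factorial : ℝ) * ∏ P ∈ π, nmoment V ν P.card := by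
  rw [← ursellOf_nmoment_eq_truncExp hV hB hK]
  exact ursellOf_eq_sum_setPartitions _ (by simpa using nmoment_zero (ν := ν) V) hK

end Literature.MathematicalPhysics.QuantumFieldTheory.Balaban1983to89.B1Eq323SetPartitions
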